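import Literature.Analysis.FunctionSpaces.SobolevNormSq
import HarnessLib

/-!
# The weak product rules `D(θ f) = Dθ f + θ Df` (smooth `θ`) and `D⟨c, d⟩ = ⟨Dc, d⟩ + ⟨c, Dd⟩`
(`c, d ∈ W^{1,2}`)

Analysis/FunctionSpaces theorem file (no new definitions, everything PROVED), a companion of
`SobolevNormSq.lean` (the chain rule `D|u|² = 2⟨u, Du⟩` for `u ∈ W^{1,2}(Ω)`,
`hasWeakFDerivOn_norm_sq`). It records the two product rules used when the local energy
balances of two different fields are combined — the weak–strong uniqueness argument for local
Leray solutions, Lemarié-Rieusset 2016, Thm. 14.7, file p. 515: "`∂ₜ(u₁·u₂) = νΔ(u₁·u₂) -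
2ν∇ ⊗ u₁·∇ ⊗ u₂ - …`", where `Δ(u₁·u₂)` is meant weakly for slices `uᵢ(t) ∈ H¹_loc` — in the
vocabulary of `FunctionSpaces.HasWeakFDerivOn` (Evans, *PDE*, §5.2.3, Thm. 1 (iv); Gilbarg–
Trudinger, (7.18)):

* `HasWeakFDerivOn.smul_contDiff` — for `θ` smooth on the whole space and `f` weakly
  differentiable on `Ω`, `θ • f` is weakly differentiable on `Ω` with derivative
  `v ↦ Dθ(x)v • f x + θ x • Df(x)v` (test the identity of `f` with the test function `φθ`);
* `HasWeakFDerivOn.inner` — for `c, d ∈ L²(Ω; F)` with weak derivatives `Gc, Gd` on `Ω` whose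
  components are square integrable, `x ↦ ⟨c x, d x⟩` is weakly differentiable on `Ω` with
  derivative `v ↦ ⟨Gc(x)v, d x⟩ + ⟨c x, Gd(x)v⟩` (polarisation
  `4⟨c,d⟩ = |c+d|² - |c-d|²` of `hasWeakFDerivOn_norm_sq`);
* `integral_fderiv_fderiv_mul_inner_eq_neg` — the tested second-order form: for a scalar test
  function `φ` on `Ω` and directions `v, w`,
  `∫_Ω ∂_w∂_vφ ⟨c, d⟩ = -∫_Ω ∂_vφ (⟨Gc w, d⟩ + ⟨c, Gd w⟩)` (the weak derivative tested with the
  test function `∂_vφ`), whose sum over an orthonormal frame is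
  "`∫ Δφ ⟨c,d⟩ = -∫ Σᵢ ∂ᵢφ (⟨Gc eᵢ, d⟩ + ⟨c, Gd eᵢ⟩)`".

## References

* L. C. Evans, *Partial Differential Equations*, 2nd ed. (2010), §5.2.3 Thm. 1 (iv).
  [`Evans2010`]
* D. Gilbarg, N. S. Trudinger, *Elliptic PDE of second order* (2001), §7.4, (7.18).
  [`GilbargTrudinger2001`]
* P. G. Lemarié-Rieusset, *The Navier–Stokes Problem in the 21st Century* (2016), Thm. 14.7,
  proof, file p. 515. [`LemarieRieusset2016`]
-/

noncomputable section

open MeasureTheory TopologicalSpace Filter Set Metric Function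
open scoped ENNReal NNReal Topology RealInnerProductSpace ContDiff

namespace Literature.Analysis.FunctionSpaces

-- nested operator types `(E' →L[ℝ] ℝ) →L[ℝ] F →L[ℝ] E' →L[ℝ] F` (`smulRightL`)
set_option maxSynthPendingDepth 3

variable {E' : Type*} [NormedAddCommGroup E'] [InnerProductSpace ℝ E'] [FiniteDimensional ℝ E']
  [MeasurableSpace E'] [BorelSpace E']

/-! ## Test functions times smooth functions -/

omit [FiniteDimensional ℝ E'] [MeasurableSpace E'] [BorelSpace E'] in
/-- The product `φ θ` of a test function `φ` on `Ω` with a smooth function `θ` is a test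
function on `Ω`. [folklore] -/
theorem IsTestFunctionOn.mul_contDiff {Ω : Opens E'} {φ θ : E' → ℝ} (hφ : IsTestFunctionOn Ω φ)
    (hθ : ContDiff ℝ ∞ θ) : IsTestFunctionOn Ω fun x => φ x * θ x :=
  ⟨hφ.contDiff.mul hθ, hφ.hasCompactSupport.mul_right,
    (tsupport_mul_subset_left (f := φ) (g := θ)).trans hφ.tsupport_subset⟩

omit [InnerProductSpace ℝ E'] [FiniteDimensional ℝ E'] in
/-- Integrability on `Ω` of `ψ • F` for `ψ` continuous with compact support inside `Ω` and `F`
locally integrable on `Ω` (the integrand of the weak-derivative identities). This is the tree's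
`SobolevApprox.integrableOn_continuous_smul` (`FunctionSpaces/SobolevTraceDensityProofs`); the name
is kept as a one-line restatement because `FluidPDE/WeakDerivAlong`,
`FluidPDE/PeriodicCylinderNeumannWeakRadial` and `FunctionSpaces/SobolevDomainGluing` use it
(dedup-00794). [folklore] -/
theorem integrableOn_smul_of_tsupport_subset {G : Type*} [NormedAddCommGroup G] [NormedSpace ℝ G]
    {Ω : Opens E'} {μ : Measure E'} {ψ : E' → ℝ} {F : E' → G} (hψ : Continuous ψ)
    (hψs : HasCompactSupport ψ) (hψΩ : tsupport ψ ⊆ (Ω : Set E'))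
    (hF : LocallyIntegrableOn F (Ω : Set E') μ) :
    IntegrableOn (fun x => ψ x • F x) (Ω : Set E') μ :=
  SobolevApprox.integrableOn_continuous_smul hψ hψs hψΩ hF

/-! ## The product with a smooth function -/

section Smul

variable {F : Type*} [NormedAddCommGroup F] [NormedSpace ℝ F] [CompleteSpace F]

omit [CompleteSpace F] in
/-- **The weak product rule `D(θ f) = Dθ ⊗ f + θ Df`** for `θ` smooth on the whole space and
`f` weakly differentiable on `Ω` (Evans, *PDE*, §5.2.3 Thm. 1 (iv) with one smooth factor;
Gilbarg–Trudinger (7.18)): the defining identity of `f` tested with the test function `φθ`,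
`∂ᵥ(φθ) = ∂ᵥφ θ + φ ∂ᵥθ`. [cite: Evans2010, §5.2.3 Thm. 1 (iv)] -/
theorem HasWeakFDerivOn.smul_contDiff {Ω : Opens E'} {μ : Measure E'} {f : E' → F} {g : E' → E' →L[ℝ] F}
    (hf : HasWeakFDerivOn Ω μ f g) {θ : E' → ℝ} (hθ : ContDiff ℝ ∞ θ) :
    HasWeakFDerivOn Ω μ (fun x => θ x • f x) fun x => (fderiv ℝ θ x).smulRight (f x) + θ x • g x := by
  have hθc : Continuous θ := hθ.continuous
  have hθd : Differentiable ℝ θ := hθ.differentiable (by simp)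
  have hDθc : Continuous (fderiv ℝ θ) := hθ.continuous_fderiv (by simp)
  have hΩlc : IsLocallyClosed (Ω : Set E') := Ω.isOpen.isLocallyClosed
  -- local integrability of `θ f` and of the derivative
  have hli : LocallyIntegrableOn (fun x => θ x • f x) (Ω : Set E') μ :=
    hf.locallyIntegrableOn.continuousOn_smul hΩlc hθc.continuousOn
  have hli' : LocallyIntegrableOn (fun x => (fderiv ℝ θ x).smulRight (f x) + θ x • g x) (Ω : Set E') μ := by
    refine LocallyIntegrableOn.add ?_ (hf.locallyIntegrableOn_deriv.continuousOn_smul hΩlc hθc.continuousOn)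
    -- `x ↦ (Dθ x).smulRight (f x)` is the image of `(Dθ x, f x)` under a continuous bilinear map
    have hfl := hf.locallyIntegrableOn
    rw [MeasureTheory.locallyIntegrableOn_iff hΩlc] at hfl ⊢
    intro K hK hKc
    have hfK := hfl K hK hKc
    obtain ⟨C, hC⟩ := hKc.exists_bound_of_continuousOn (hDθc.continuousOn)
    refine Integrable.mono' (hfK.norm.const_mul C) ?_ ?_
    · exact ((ContinuousLinearMap.smulRightL ℝ E' F).continuous₂.comp_aestronglyMeasurable
        ((hDθc.aestronglyMeasurable.restrict).prodMk hfK.aestronglyMeasurable))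
    · filter_upwards [ae_restrict_mem hKc.measurableSet] with x hx
      calc ‖(fderiv ℝ θ x).smulRight (f x)‖ = ‖fderiv ℝ θ x‖ * ‖f x‖ :=
            ContinuousLinearMap.norm_smulRight_apply _ _
        _ ≤ C * ‖f x‖ := by gcongr; exact hC x hx
  refine ⟨hli, hli', fun φ v hφ => ?_⟩
  -- the test function `φ θ`
  have hφθ : IsTestFunctionOn Ω fun x => φ x * θ x := hφ.mul_contDiff hθ
  have key := hf.integral_fderiv_smul_eq (fun x => φ x * θ x) v hφθ
  have hφd : Differentiable ℝ φ := hφ.contDiff.differentiable (by simp)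
  have hDφc : Continuous (fderiv ℝ φ) := hφ.contDiff.continuous_fderiv (by simp)
  have hprod : ∀ x, fderiv ℝ (fun x => φ x * θ x) x v = fderiv ℝ φ x v * θ x + φ x * fderiv ℝ θ x v := by
    intro x
    rw [fderiv_fun_mul (hφd x) (hθd x)]
    simp only [add_apply, smul_apply, smul_eq_mul]
    ring
  -- integrability of the four pieces
  have hφ'c : Continuous fun x => fderiv ℝ φ x v := hDφc.clm_apply continuous_const
  have hφ's : HasCompactSupport fun x => fderiv ℝ φ x v := hφ.hasCompactSupport.fderiv_apply (𝕜 := ℝ) v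
  have hφ'Ω : tsupport (fun x => fderiv ℝ φ x v) ⊆ (Ω : Set E') :=
    (tsupport_fderiv_apply_subset ℝ v).trans hφ.tsupport_subset
  have I1 : IntegrableOn (fun x => (fderiv ℝ φ x v) • (θ x • f x)) (Ω : Set E') μ :=
    integrableOn_smul_of_tsupport_subset hφ'c hφ's hφ'Ω hli
  have I2 : IntegrableOn (fun x => φ x • ((fderiv ℝ θ x v) • f x)) (Ω : Set E') μ :=
    integrableOn_smul_of_tsupport_subset hφ.contDiff.continuous hφ.hasCompactSupport hφ.tsupport_subset
      (hf.locallyIntegrableOn.continuousOn_smul hΩlc (hDθc.clm_apply continuous_const).continuousOn)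
  have I3 : IntegrableOn (fun x => φ x • (θ x • g x v)) (Ω : Set E') μ :=
    integrableOn_smul_of_tsupport_subset hφ.contDiff.continuous hφ.hasCompactSupport hφ.tsupport_subset
      (((ContinuousLinearMap.apply ℝ F v).locallyIntegrableOn_comp hf.locallyIntegrableOn_deriv).continuousOn_smul
        hΩlc hθc.continuousOn)
  -- rewrite `key`
  have hL : (fun x => fderiv ℝ (fun x => φ x * θ x) x v • f x) =
      fun x => (fderiv ℝ φ x v) • (θ x • f x) + φ x • ((fderiv ℝ θ x v) • f x) := by
    funext x
    rw [hprod, add_smul, mul_smul, mul_smul]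
  have hR : (fun x => (φ x * θ x) • g x v) = fun x => φ x • (θ x • g x v) := by
    funext x; rw [mul_smul]
  rw [hL, hR, integral_add I1 I2] at key
  -- conclude
  have e : (fun x => φ x • ((fderiv ℝ θ x).smulRight (f x) + θ x • g x) v) =
      fun x => φ x • ((fderiv ℝ θ x v) • f x) + φ x • (θ x • g x v) := by
    funext x
    simp only [add_apply, ContinuousLinearMap.smulRight_apply, smul_apply,
      smul_add]
  rw [e, integral_add I2 I3]
  rw [eq_sub_of_add_eq key]
  abel

end Smul

/-! ## The inner product of two `W^{1,2}` fields -/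

section Inner

variable {F : Type*} [NormedAddCommGroup F] [InnerProductSpace ℝ F] [CompleteSpace F]
variable {Ω : Opens E'} {μ : Measure E'} [μ.IsAddHaarMeasure]

/-- **The weak product rule `D⟨c, d⟩ = ⟨Dc, d⟩ + ⟨c, Dd⟩` for `c, d ∈ W^{1,2}(Ω; F)`**
(Evans, *PDE*, §5.2.3 Thm. 1 (iv); Gilbarg–Trudinger (7.18)): if `c, d ∈ L²(Ω)` have weak
derivatives `Gc, Gd` on `Ω` with square-integrable components, then `x ↦ ⟨c x, d x⟩` has the
weak derivative `v ↦ ⟨Gc(x) v, d x⟩ + ⟨c x, Gd(x) v⟩` on `Ω` — by polarisation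
`4⟨c, d⟩ = |c + d|² - |c - d|²` of the chain rule `hasWeakFDerivOn_norm_sq`.
[cite: Evans2010, §5.2.3 Thm. 1 (iv)] -/
theorem HasWeakFDerivOn.inner {c d : E' → F} {Gc Gd : E' → E' →L[ℝ] F}
    (hc2 : MemLp c 2 (μ.restrict Ω)) (hd2 : MemLp d 2 (μ.restrict Ω))
    (hc : HasWeakFDerivOn Ω μ c Gc) (hd : HasWeakFDerivOn Ω μ d Gd)
    (hGc2 : ∀ v, MemLp (fun x => Gc x v) 2 (μ.restrict Ω)) (hGd2 : ∀ v, MemLp (fun x => Gd x v) 2 (μ.restrict Ω)) :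
    HasWeakFDerivOn Ω μ (fun x => ⟪c x, d x⟫)
      fun x => (innerSL ℝ (d x)).comp (Gc x) + (innerSL ℝ (c x)).comp (Gd x) := by
  -- `c + d` is weakly differentiable (the tree has `.sub` and `.const_smul`)
  have hadd : HasWeakFDerivOn Ω μ (c + d) (Gc + Gd) := by
    have h := hc.sub (hd.const_smul (-1 : ℝ))
    have e1 : c - (-1 : ℝ) • d = c + d := by
      funext x; simp
    have e2 : Gc - (-1 : ℝ) • Gd = Gc + Gd := by
      funext x; simp
    rw [e1, e2] at h
    exact h
  -- the chain rule for `c + d` and `c - d`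
  have hp : HasWeakFDerivOn Ω μ (fun x => ‖(c + d) x‖ ^ 2)
      (fun x => (2 : ℝ) • (innerSL ℝ ((c + d) x)).comp ((Gc + Gd) x)) :=
    hasWeakFDerivOn_norm_sq (hc2.add hd2) hadd fun v => (hGc2 v).add (hGd2 v)
  have hm : HasWeakFDerivOn Ω μ (fun x => ‖(c - d) x‖ ^ 2)
      (fun x => (2 : ℝ) • (innerSL ℝ ((c - d) x)).comp ((Gc - Gd) x)) :=
    hasWeakFDerivOn_norm_sq (hc2.sub hd2) (hc.sub hd) fun v => (hGc2 v).sub (hGd2 v)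
  have hpol := (hp.sub hm).const_smul (4⁻¹ : ℝ)
  -- identify the functions
  have e1 : ((4⁻¹ : ℝ) • ((fun x => ‖(c + d) x‖ ^ 2) - fun x => ‖(c - d) x‖ ^ 2)) = fun x => ⟪c x, d x⟫ := by
    funext x
    simp only [Pi.smul_apply, Pi.sub_apply, Pi.add_apply, smul_eq_mul]
    rw [@norm_add_sq_real, @norm_sub_sq_real]
    ring
  have e2 : ((4⁻¹ : ℝ) • ((fun x => (2 : ℝ) • (innerSL ℝ ((c + d) x)).comp ((Gc + Gd) x)) -
      fun x => (2 : ℝ) • (innerSL ℝ ((c - d) x)).comp ((Gc - Gd) x))) =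
      fun x => (innerSL ℝ (d x)).comp (Gc x) + (innerSL ℝ (c x)).comp (Gd x) := by
    funext x
    ext v
    simp only [Pi.smul_apply, Pi.sub_apply, Pi.add_apply, smul_apply,
      sub_apply, add_apply, ContinuousLinearMap.coe_comp, comp_apply,
      innerSL_apply_apply, smul_eq_mul, inner_add_left, inner_sub_left, inner_add_right, inner_sub_right]
    ring
  rw [e1, e2] at hpol
  exact hpol

/-- **The tested second-order form of the product rule:** for `c, d ∈ W^{1,2}(Ω; F)` as in
`HasWeakFDerivOn.inner`, a scalar test function `φ` on `Ω` and directions `v, w`,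
`∫_Ω ∂_w∂_vφ ⟨c, d⟩ = -∫_Ω ∂_vφ (⟨Gc w, d⟩ + ⟨c, Gd w⟩)` (the weak derivative of `⟨c,d⟩` tested
with the test function `∂_vφ`). Summed over an orthonormal frame with `v = w = eᵢ` this is the weak
form of "`∫ Δφ (u₁·u₂) = -∫ ∇φ·∇(u₁·u₂)`" used when the balances of `|u₁|²`, `|u₂|²` and
`u₁·u₂` are combined (Lemarié-Rieusset 2016, Thm. 14.7, proof, p. 515).
[cite: Evans2010, §5.2.3 Thm. 1 (iv)] -/
theorem integral_fderiv_fderiv_mul_inner_eq_neg {c d : E' → F} {Gc Gd : E' → E' →L[ℝ] F}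
    (hc2 : MemLp c 2 (μ.restrict Ω)) (hd2 : MemLp d 2 (μ.restrict Ω))
    (hc : HasWeakFDerivOn Ω μ c Gc) (hd : HasWeakFDerivOn Ω μ d Gd)
    (hGc2 : ∀ v, MemLp (fun x => Gc x v) 2 (μ.restrict Ω)) (hGd2 : ∀ v, MemLp (fun x => Gd x v) 2 (μ.restrict Ω))
    {φ : E' → ℝ} (hφ : IsTestFunctionOn Ω φ) (v w : E') :
    ∫ x in (Ω : Set E'), fderiv ℝ (fderiv ℝ φ) x w v * ⟪c x, d x⟫ ∂μ =
      -∫ x in (Ω : Set E'), fderiv ℝ φ x v * (⟪Gc x w, d x⟫ + ⟪c x, Gd x w⟫) ∂μ := by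
  have hW := HasWeakFDerivOn.inner hc2 hd2 hc hd hGc2 hGd2
  -- the test function `∂_v φ`
  have hψ : IsTestFunctionOn Ω fun x => fderiv ℝ φ x v :=
    ⟨(hφ.contDiff.fderiv_right (m := (⊤ : ℕ∞)) le_rfl).clm_apply contDiff_const,
      hφ.hasCompactSupport.fderiv_apply (𝕜 := ℝ) v,
      (tsupport_fderiv_apply_subset ℝ v).trans hφ.tsupport_subset⟩
  have key := hW.integral_fderiv_smul_eq (fun x => fderiv ℝ φ x v) w hψ
  have hDφd : Differentiable ℝ (fderiv ℝ φ) :=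
    (hφ.contDiff.fderiv_right (m := (⊤ : ℕ∞)) le_rfl).differentiable (by simp)
  have hd1 : ∀ x, fderiv ℝ (fun x => fderiv ℝ φ x v) x w = fderiv ℝ (fderiv ℝ φ) x w v := by
    intro x
    rw [fderiv_clm_apply (hDφd x) (differentiableAt_const v)]
    simp
  simp only [hd1, smul_eq_mul] at key
  rw [key]
  congr 1
  refine integral_congr_ae (Eventually.of_forall fun x => ?_)
  simp only [add_apply, ContinuousLinearMap.coe_comp, comp_apply, innerSL_apply_apply,
    real_inner_comm (d x)]

end Inner

end Literature.Analysis.FunctionSpaces
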